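import Mathlib
import Literature.Geometry.Symplectic.JHolomorphicMap
import Literature.Topology.PlaneTopology.WindingNumber
import Summits.SmoothPoincare4.SmoothPoincare4.Theorems.SullivanDualTameOrBrodyR4PencilDefs
import Summits.SmoothPoincare4.SmoothPoincare4.Theorems.SullivanDualTameOrBrodyR4ContinuityEstimates
import Summits.SmoothPoincare4.SmoothPoincare4.Theorems.SullivanDualTameOrBrodyR4HelperGeneralisedArgumentPrinciple

/-!
# Far crossings of an asymptotically flat `J`-holomorphic plane (stub `helper_farCrossings`, line Sketch)

Crux `stmt-SmoothPoincare4-7826` (`TameOrBrodyR4`), line `Sketch`, in the vocabulary of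
`Theorems/SullivanDualTameOrBrodyR4PencilDefs.lean`: `J` on `ℝ⁴` is standard (`= i` in the frame
`(P, Q)`) where `‖x‖ ≥ R`, and `u : ℂ → ℝ⁴` is a `C^∞` flat-`J`-holomorphic map whose
`P`-coordinate is asymptotically the identity, `P (u ξ) - ξ → 0` at infinity. Then `u` has the two
"far crossing" properties of a pencil member (`IsPencilMember`): every far value `c`, `|c| > 2R`,
is taken by `f := P ∘ u` at exactly one parameter, and the real differential of `f` is invertible
wherever `|f| > 2R`.

Proof (namespace `FarCrossings`, for an abstract continuous `f : ℂ → ℂ`, holomorphic on an open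
set `S` containing the level set `{f = c}`, with `f - id → 0` at infinity):

* `f` is holomorphic on the open set `{R < ‖u‖}` (`Continuity.differentiableAt_coord`), which
  contains every far level set since `‖u‖ ≥ |P ∘ u|` (`PencilDefs.norm_P_le`).
* The level set `{f = c}` is finite: bounded (`‖f ξ - ξ‖ < 1` for `‖ξ‖ ≥ L`, so `f ξ ≠ c` for
  `‖ξ‖ ≥ max L (|c| + 1)`), closed, and discrete (identity theorem; the set of points near which
  `f ≡ c` is clopen and, if nonempty, everything — impossible since `f - id → 0`). This is the
  bookkeeping of `…HelperFarMemberFlat.lean`, adapted.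
* On the circle `‖ξ‖ = ρ := max L (|c| + 1)` the loop `f - c` is Rouché-close to `ξ - c`
  (`‖(f ξ - c) - (ξ - c)‖ = ‖f ξ - ξ‖ < 1 ≤ ‖ξ‖ - |c| ≤ ‖ξ - c‖`), so its winding number is that
  of `ξ - c`, namely `1` (`wind_eq_of_norm_sub_lt`, `wind_circleLoop_sub_of_norm_lt`).
* The generalised argument principle (`GenArgPrinciple.ncard_le_wind`,
  `GenArgPrinciple.wind_eq_zero_of_forall_ne_zero`) gives exactly one zero `z₀` of `f - c`.
* Simplicity: `f - c = (z - z₀)^m · h` near `z₀` with `h z₀ ≠ 0` (`GenArgPrinciple.exists_pow_mul`);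
  dividing out (`GenArgPrinciple.divide_out`) leaves a zero-free quotient, so `1 = wind = m`, and
  `f` has complex derivative `h z₀ ≠ 0` at `z₀`; its real differential `v ↦ h z₀ • v`
  (`HasDerivAt.complexToReal_fderiv`) is bijective.

References: M. Gromov, Invent. Math. 82 (1985), §2.4.A; the winding number API of
`Literature/Topology/PlaneTopology/WindingNumber.lean`.
-/

-- the registered namespace `Summit.SmoothPoincare4.SmoothPoincare4.…` repeats a component
set_option linter.dupNamespace false

noncomputable section

open scoped ContDiff Topology
open Filter Set Metric Literature.Geometry.Symplectic
open Literature.Topology.PlaneTopology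

namespace Summit.SmoothPoincare4.SmoothPoincare4.Cruxes.TameOrBrodyR4.Sketch

/-- Local notation for the model space `ℝ⁴ = EuclideanSpace ℝ (Fin 4)`. -/
local notation "E4" => EuclideanSpace ℝ (Fin 4)

namespace FarCrossings

/-- **A tail radius.** If `f ξ - ξ → 0` at infinity, then `‖f ξ - ξ‖ < 1` for `‖ξ‖ ≥ L`. -/
theorem exists_tail_radius {f : ℂ → ℂ} (hlim : Tendsto (fun ξ => f ξ - ξ) (cocompact ℂ) (𝓝 0)) :
    ∃ L : ℝ, ∀ ξ : ℂ, L ≤ ‖ξ‖ → ‖f ξ - ξ‖ < 1 := by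
  have hev : ∀ᶠ ξ in cocompact ℂ, ‖f ξ - ξ‖ < 1 :=
    (NormedAddGroup.tendsto_nhds_zero.mp hlim) 1 one_pos
  rw [Filter.eventually_iff, Filter.mem_cocompact] at hev
  obtain ⟨K, hK, hKs⟩ := hev
  obtain ⟨r, hr⟩ := hK.isBounded.subset_closedBall 0
  refine ⟨r + 1, fun ξ hξ => ?_⟩
  have hξK : ξ ∉ K := fun hξK => by
    have h1 := mem_closedBall_zero_iff.mp (hr hξK)
    linarith
  exact hKs hξK

/-- **Rouché closeness outside the tail radius.** For `‖ξ‖ ≥ max L (‖c‖ + 1)` one has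
`‖(f ξ - c) - (ξ - c)‖ < ‖ξ - c‖`. -/
theorem norm_sub_sub_lt {f : ℂ → ℂ} {L : ℝ} (hL : ∀ ξ : ℂ, L ≤ ‖ξ‖ → ‖f ξ - ξ‖ < 1) (c : ℂ)
    {ξ : ℂ} (hξ : max L (‖c‖ + 1) ≤ ‖ξ‖) : ‖(f ξ - c) - (ξ - c)‖ < ‖ξ - c‖ := by
  have h1 : ‖f ξ - ξ‖ < 1 := hL ξ ((le_max_left _ _).trans hξ)
  have h2 : ‖c‖ + 1 ≤ ‖ξ‖ := (le_max_right _ _).trans hξ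
  have h3 : ‖ξ‖ - ‖c‖ ≤ ‖ξ - c‖ := norm_sub_norm_le ξ c
  calc ‖(f ξ - c) - (ξ - c)‖ = ‖f ξ - ξ‖ := by congr 1; ring
    _ < 1 := h1
    _ ≤ ‖ξ - c‖ := by linarith

/-- The level set `{f = c}` lies in the open disc of radius `max L (‖c‖ + 1)`. -/
theorem norm_lt_of_eq {f : ℂ → ℂ} {L : ℝ} (hL : ∀ ξ : ℂ, L ≤ ‖ξ‖ → ‖f ξ - ξ‖ < 1) {c ξ : ℂ}
    (hξ : f ξ = c) : ‖ξ‖ < max L (‖c‖ + 1) := by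
  by_contra hle
  have h := norm_sub_sub_lt hL c (not_lt.mp hle)
  rw [hξ, sub_self, zero_sub, norm_neg] at h
  exact lt_irrefl _ h

/-- **No global constancy.** `f ξ - ξ → 0` at infinity rules out `f ≡ c`. -/
theorem not_forall_eq {f : ℂ → ℂ} (hlim : Tendsto (fun ξ => f ξ - ξ) (cocompact ℂ) (𝓝 0))
    (c : ℂ) : ¬ ∀ ξ, f ξ = c := by
  intro hall
  obtain ⟨L, hL⟩ := exists_tail_radius hlim
  have hρ0 : 0 ≤ max L (‖c‖ + 1) := le_trans (by positivity) (le_max_right _ _)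
  have h := norm_lt_of_eq hL (hall ((max L (‖c‖ + 1) : ℝ) : ℂ))
  rw [Complex.norm_of_nonneg hρ0] at h
  exact lt_irrefl _ h

/-- **No local constancy.** A continuous `f : ℂ → ℂ`, holomorphic on an open set `S` containing
the level set `{f = c}`, with `f ξ - ξ → 0` at infinity, is not eventually equal to `c` near any
point: the set of points near which `f ≡ c` is open, closed (identity theorem on a small disc
around a limit point, which lies in the level set and hence in `S`) and, if nonempty, all of `ℂ`;
but `f ≡ c` is impossible. (Adapted from `FarMemberFlat.not_eventually_eq`.) -/
theorem not_eventually_eq {f : ℂ → ℂ} {S : Set ℂ} {c : ℂ} (hfc : Continuous f)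
    (hS : IsOpen S) (hfd : DifferentiableOn ℂ f S) (hcS : ∀ ξ, f ξ = c → ξ ∈ S)
    (hlim : Tendsto (fun ξ => f ξ - ξ) (cocompact ℂ) (𝓝 0)) (ξ₀ : ℂ) :
    ¬ ∀ᶠ η in 𝓝 ξ₀, f η = c := by
  intro hξ₀
  have han : AnalyticOnNhd ℂ f S := hfd.analyticOnNhd hS
  -- the set of points near which `f ≡ c` is clopen and nonempty, hence everything
  have hAopen : IsOpen {ξ : ℂ | ∀ᶠ η in 𝓝 ξ, f η = c} := isOpen_setOf_eventually_nhds
  have hAclosed : IsClosed {ξ : ℂ | ∀ᶠ η in 𝓝 ξ, f η = c} := by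
    refine isClosed_of_closure_subset fun ξ hξ => ?_
    have hξc : f ξ = c := by
      have hsub : {ξ : ℂ | ∀ᶠ η in 𝓝 ξ, f η = c} ⊆ {η | f η = c} := fun η hη => hη.self_of_nhds
      exact ((isClosed_eq hfc continuous_const).closure_subset_iff.2 hsub) hξ
    obtain ⟨ε, hε, hball⟩ := Metric.isOpen_iff.1 hS ξ (hcS ξ hξc)
    obtain ⟨η, hηball, hηA⟩ := mem_closure_iff_nhds.1 hξ (ball ξ ε) (ball_mem_nhds ξ hε)
    have heq : EqOn f (fun _ => c) (ball ξ ε) :=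
      (han.mono hball).eqOn_of_preconnected_of_eventuallyEq analyticOnNhd_const
        (convex_ball ξ ε).isPreconnected hηball hηA
    exact eventually_of_mem (ball_mem_nhds ξ hε) fun η hη => heq hη
  have hall : ∀ ξ, f ξ = c := fun ξ => by
    have hξA : ξ ∈ {ξ : ℂ | ∀ᶠ η in 𝓝 ξ, f η = c} :=
      (IsClopen.eq_univ ⟨hAclosed, hAopen⟩ ⟨ξ₀, hξ₀⟩).symm ▸ mem_univ ξ
    exact hξA.self_of_nhds
  exact not_forall_eq hlim c hall

/-- **Isolated level points.** In the setting of `not_eventually_eq`, every point of the level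
set `{f = c}` is isolated in it. -/
theorem eventually_ne {f : ℂ → ℂ} {S : Set ℂ} {c : ℂ} (hfc : Continuous f)
    (hS : IsOpen S) (hfd : DifferentiableOn ℂ f S) (hcS : ∀ ξ, f ξ = c → ξ ∈ S)
    (hlim : Tendsto (fun ξ => f ξ - ξ) (cocompact ℂ) (𝓝 0)) {ξ : ℂ} (hξ : f ξ = c) :
    ∀ᶠ z in 𝓝[≠] ξ, f z ≠ c := by
  have han : AnalyticAt ℂ (fun z => f z - c) ξ :=
    ((hfd.analyticOnNhd hS) ξ (hcS ξ hξ)).sub analyticAt_const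
  rcases han.eventually_eq_zero_or_eventually_ne_zero with h | h
  · exact absurd (h.mono fun z hz => sub_eq_zero.1 hz)
      (not_eventually_eq hfc hS hfd hcS hlim ξ)
  · exact h.mono fun z hz => sub_ne_zero.1 hz

/-- **Finiteness of the level set.** In the setting of `not_eventually_eq` the level set
`{f = c}` is finite: it is closed, bounded (by the tail radius) and consists of isolated
points. -/
theorem finite_level {f : ℂ → ℂ} {S : Set ℂ} {c : ℂ} (hfc : Continuous f)
    (hS : IsOpen S) (hfd : DifferentiableOn ℂ f S) (hcS : ∀ ξ, f ξ = c → ξ ∈ S)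
    (hlim : Tendsto (fun ξ => f ξ - ξ) (cocompact ℂ) (𝓝 0)) : {ξ : ℂ | f ξ = c}.Finite := by
  obtain ⟨L, hL⟩ := exists_tail_radius hlim
  have hZK : {ξ : ℂ | f ξ = c} ⊆ closedBall (0 : ℂ) (max L (‖c‖ + 1)) := fun ξ hξ =>
    mem_closedBall_zero_iff.mpr (norm_lt_of_eq hL hξ).le
  by_contra hinf
  obtain ⟨x, -, hx⟩ := (Set.not_finite.mp hinf : Set.Infinite _).exists_accPt_of_subset_isCompact
    (isCompact_closedBall (0 : ℂ) _) hZK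
  rw [accPt_iff_frequently_nhdsNE] at hx
  -- `x` lies in the closed level set ...
  have hxc : f x = c := by
    have hcl : x ∈ closure {ξ : ℂ | f ξ = c} :=
      mem_closure_iff_frequently.mpr (hx.filter_mono nhdsWithin_le_nhds)
    exact (isClosed_eq hfc continuous_const).closure_subset hcl
  -- ... and is isolated in it
  exact hx (eventually_ne hfc hS hfd hcS hlim hxc)

/-- **Winding number one at infinity.** On the circle of radius `ρ := max L (‖c‖ + 1)` the loop
`f - c` is Rouché-close to `ξ - c`, which winds once about `0` since `‖c‖ < ρ`. -/
theorem wind_eq_one {f : ℂ → ℂ} (hfc : Continuous f) {L : ℝ}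
    (hL : ∀ ξ : ℂ, L ≤ ‖ξ‖ → ‖f ξ - ξ‖ < 1) (c : ℂ) :
    wind (fun s => f (circleLoop 0 (max L (‖c‖ + 1)) s) - c) = 1 := by
  set ρ : ℝ := max L (‖c‖ + 1)
  have hcρ : ‖c‖ < ρ := lt_of_lt_of_le (lt_add_one _) (le_max_right _ _)
  have hρ : 0 < ρ := (norm_nonneg c).trans_lt hcρ
  have hbase : IsNonvanishingLoop (fun t => circleLoop 0 ρ t - c) := by
    have h := isNonvanishingLoop_circleLoop (c := -c) (R := ρ) (by
      rw [norm_neg, abs_of_pos hρ]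
      exact hcρ.ne)
    exact h.congr fun t _ => by rw [circleLoop_sub, zero_sub]
  have hw : wind (fun t => circleLoop 0 ρ t - c) = 1 :=
    wind_circleLoop_sub_of_norm_lt (by rwa [sub_zero])
  rw [← hw]
  refine wind_eq_of_norm_sub_lt
    ((hfc.comp (continuous_circleLoop 0 ρ)).sub continuous_const).continuousOn
    (by rw [circleLoop_zero_eq]) hbase fun s _ => ?_
  have h1 : ‖circleLoop 0 ρ s‖ = ρ := by simpa using circleLoop_mem_sphere 0 hρ.le s
  exact norm_sub_sub_lt hL c (le_of_eq h1.symm)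

/-- **Far crossings, abstract form.** A continuous `f : ℂ → ℂ`, holomorphic on an open set `S`
containing the level set `{f = c}`, with `f ξ - ξ → 0` at infinity, takes the value `c` at exactly
one point, and its real differential there is bijective (the zero of `f - c` is simple, by the
winding number count `1 = m`). -/
theorem existsUnique_and_bijective {f : ℂ → ℂ} {S : Set ℂ} {c : ℂ} (hfc : Continuous f)
    (hS : IsOpen S) (hfd : DifferentiableOn ℂ f S) (hcS : ∀ ξ, f ξ = c → ξ ∈ S)
    (hlim : Tendsto (fun ξ => f ξ - ξ) (cocompact ℂ) (𝓝 0)) :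
    (∃! ξ, f ξ = c) ∧ ∀ ξ, f ξ = c → Function.Bijective (fderiv ℝ f ξ) := by
  obtain ⟨L, hL⟩ := exists_tail_radius hlim
  set ρ : ℝ := max L (‖c‖ + 1)
  have hcρ : ‖c‖ < ρ := lt_of_lt_of_le (lt_add_one _) (le_max_right _ _)
  have hρ : 0 < ρ := (norm_nonneg c).trans_lt hcρ
  -- the shifted function `g := f - c` and its zeros in the closed disc `‖z‖ ≤ ρ`
  set g : ℂ → ℂ := fun ξ => f ξ - c
  have hg0 : ∀ ξ, g ξ = 0 ↔ f ξ = c := fun ξ => sub_eq_zero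
  have hgc : ContinuousOn g (closedBall 0 ρ) := (hfc.sub continuous_const).continuousOn
  have hgd : DifferentiableOn ℂ g S := hfd.sub (differentiableOn_const c)
  have hZρ : ∀ ξ, f ξ = c → ‖ξ‖ < ρ := fun ξ hξ => norm_lt_of_eq hL hξ
  have hZfin : {z : ℂ | z ∈ closedBall (0 : ℂ) ρ ∧ g z = 0}.Finite :=
    (finite_level hfc hS hfd hcS hlim).subset fun z hz => (hg0 z).mp hz.2
  have hin : ∀ z ∈ closedBall (0 : ℂ) ρ, g z = 0 →
      ‖z‖ < ρ ∧ ∃ s ∈ 𝓝 z, DifferentiableOn ℂ g s := fun z _ hz =>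
    ⟨hZρ z ((hg0 z).mp hz), S, hS.mem_nhds (hcS z ((hg0 z).mp hz)), hgd⟩
  have hmemZ : ∀ ξ, f ξ = c → ξ ∈ {z : ℂ | z ∈ closedBall (0 : ℂ) ρ ∧ g z = 0} := fun ξ hξ =>
    ⟨mem_closedBall_zero_iff.mpr (hZρ ξ hξ).le, (hg0 ξ).mpr hξ⟩
  -- winding number one along the boundary circle: at most one zero, and at least one
  have hw1 : wind (fun s => g (circleLoop 0 ρ s)) = 1 := wind_eq_one hfc hL c
  have hcard : {z : ℂ | z ∈ closedBall (0 : ℂ) ρ ∧ g z = 0}.ncard ≤ 1 := by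
    have key := GenArgPrinciple.ncard_le_wind hρ _ g hgc hZfin rfl hin
    rw [hw1] at key
    exact_mod_cast key
  obtain ⟨z₀, hz₀Z⟩ : {z : ℂ | z ∈ closedBall (0 : ℂ) ρ ∧ g z = 0}.Nonempty := by
    by_contra hempty
    have hne : ∀ z ∈ closedBall (0 : ℂ) ρ, g z ≠ 0 := fun z hz h0 => hempty ⟨z, hz, h0⟩
    have h0 := GenArgPrinciple.wind_eq_zero_of_forall_ne_zero hρ hgc hne
    rw [hw1] at h0
    exact one_ne_zero h0
  have huniq : ∀ ξ, f ξ = c → ξ = z₀ := fun ξ hξ =>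
    (ncard_le_one hZfin).mp hcard ξ (hmemZ ξ hξ) z₀ hz₀Z
  have hfz₀ : f z₀ = c := (hg0 z₀).mp hz₀Z.2
  -- the zero `z₀` is simple: factor `g = (z - z₀)^m • h` and count the winding number again
  have hnotev : ¬ ∀ᶠ z in 𝓝 z₀, g z = 0 := fun hev =>
    not_eventually_eq hfc hS hfd hcS hlim z₀ (hev.mono fun z hz => (hg0 z).mp hz)
  obtain ⟨m, h, -, hh, hh0, hfac⟩ := GenArgPrinciple.exists_pow_mul
    (hgd.analyticAt (hS.mem_nhds (hcS z₀ hfz₀))) hz₀Z.2 hnotev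
  obtain ⟨g₁, hg₁, hZ₁, -, hw⟩ :=
    GenArgPrinciple.divide_out hρ hgc hin (hZρ z₀ hfz₀) hh hh0 hfac
  have hne₁ : ∀ z ∈ closedBall (0 : ℂ) ρ, g₁ z ≠ 0 := fun z hz h0 => by
    have hmem : z ∈ {z : ℂ | z ∈ closedBall (0 : ℂ) ρ ∧ g₁ z = 0} := ⟨hz, h0⟩
    rw [hZ₁] at hmem
    exact hmem.2 (mem_singleton_iff.mpr (huniq z ((hg0 z).mp hmem.1.2)))
  have hm1 : m = 1 := by
    have h0 := GenArgPrinciple.wind_eq_zero_of_forall_ne_zero hρ hg₁ hne₁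
    rw [hw1, h0, add_zero] at hw
    exact_mod_cast hw.symm
  -- so `f` has complex derivative `h z₀ ≠ 0` at `z₀`, and real differential `v ↦ h z₀ • v`
  have hderiv : HasDerivAt f (h z₀) z₀ := by
    have h2 : HasDerivAt (fun y => (y - z₀) * h y + c) (h z₀) z₀ :=
      ((((hasDerivAt_id' (x := z₀)).sub_const z₀).mul hh.differentiableAt.hasDerivAt).add_const
        c).congr_deriv (by ring)
    refine h2.congr_of_eventuallyEq ?_
    filter_upwards [hfac] with z hz
    rw [hm1, pow_one] at hz
    have hz' : f z - c = (z - z₀) * h z := hz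
    show f z = (z - z₀) * h z + c
    linear_combination hz'
  have hbij : Function.Bijective (fderiv ℝ f z₀) := by
    rw [hderiv.complexToReal_fderiv.fderiv]
    constructor
    · intro v w hvw
      have hvw' : h z₀ * v = h z₀ * w := hvw
      exact mul_left_cancel₀ hh0 hvw'
    · intro w
      refine ⟨w / h z₀, ?_⟩
      show h z₀ * (w / h z₀) = w
      exact mul_div_cancel₀ w hh0
  exact ⟨⟨z₀, hfz₀, huniq⟩, fun ξ hξ => by rw [huniq ξ hξ]; exact hbij⟩

end FarCrossings

/-- **Registered helper `helper_farCrossings` (FAR): far crossings of an asymptotically flat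
`J`-holomorphic plane.** If `J` is standard on `‖x‖ ≥ R` in the frame `(P, Q)` and `u : ℂ → ℝ⁴` is
`C^∞`, flat-`J`-holomorphic and normalised by `P (u ξ) - ξ → 0` at infinity, then every far value
`c`, `|c| > 2R`, is taken by `P ∘ u` at exactly one parameter, and the real differential of
`P ∘ u` is bijective wherever `|P ∘ u| > 2R` (generalised argument principle on a large circle,
where `P ∘ u - c` is Rouché-close to `ξ - c`). -/
theorem helper_farCrossings (J : E4 → E4 →L[ℝ] E4) (R : ℝ) (P Q : E4 →L[ℝ] ℂ)
    (eP eQ : ℂ →L[ℝ] E4) (hR : 0 < R) (hJs : ContDiff ℝ ∞ J) (hJ2 : ∀ x v, J x (J x v) = -v)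
    (hPQ : IsCoordFrame P Q eP eQ)
    (hJP : ∀ x : E4, R ≤ ‖x‖ → ∀ v, P (J x v) = Complex.I * P v)
    (hJQ : ∀ x : E4, R ≤ ‖x‖ → ∀ v, Q (J x v) = Complex.I * Q v) (u : ℂ → E4)
    (hus : ContDiff ℝ ∞ u) (huJ : IsJHolomorphicFlat J u)
    (hP : Tendsto (fun ξ => P (u ξ) - ξ) (cocompact ℂ) (𝓝 0)) :
    (∀ c : ℂ, 2 * R < ‖c‖ → ∃! ξ, P (u ξ) = c) ∧
      (∀ ξ : ℂ, 2 * R < ‖P (u ξ)‖ → Function.Bijective (fderiv ℝ (fun ξ => P (u ξ)) ξ)) := by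
  -- `hJs`, `hJ2`, `hJQ` are not needed: only the `P`-coordinate and its standardness matter
  have _ := hJs
  have _ := hJ2
  have _ := hJQ
  have hfc : Continuous fun ξ => P (u ξ) := P.continuous.comp hus.continuous
  -- holomorphy of `P ∘ u` on the open set `{R < ‖u‖}`, which contains every far level set
  have hΩ : IsOpen {ξ : ℂ | R < ‖u ξ‖} := isOpen_lt continuous_const hus.continuous.norm
  have hfd : DifferentiableOn ℂ (fun ξ => P (u ξ)) {ξ : ℂ | R < ‖u ξ‖} := fun ξ hξ =>
    (Continuity.differentiableAt_coord P hJP hus huJ (le_of_lt hξ)).differentiableWithinAt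
  have hcS : ∀ c : ℂ, 2 * R < ‖c‖ → ∀ ξ, P (u ξ) = c → ξ ∈ {ξ : ℂ | R < ‖u ξ‖} :=
    fun c hc ξ hξ => by
      show R < ‖u ξ‖
      calc R < 2 * R := by linarith
        _ < ‖c‖ := hc
        _ = ‖P (u ξ)‖ := by rw [hξ]
        _ ≤ ‖u ξ‖ := PencilDefs.norm_P_le hPQ _
  exact ⟨fun c hc => (FarCrossings.existsUnique_and_bijective hfc hΩ hfd (hcS c hc) hP).1,
    fun ξ hξ => (FarCrossings.existsUnique_and_bijective hfc hΩ hfd (hcS _ hξ) hP).2 ξ rfl⟩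

end Summit.SmoothPoincare4.SmoothPoincare4.Cruxes.TameOrBrodyR4.Sketch
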